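import Literature.Combinatorics.Hypergraph.Containers
import Mathlib.Data.Nat.Choose.Bounds
import Mathlib.Analysis.Complex.ExponentialBounds
import HarnessLib

/-!
# Iterated hypergraph containers (few edges) and first-moment sparsification — fully proved

Two generic complements to the container theorem of
`Literature/Combinatorics/Hypergraph/Containers.lean` (Bernshteyn–Delcourt–Towsner–Tserunyan's
Theorem 8), both needed to turn it into Nenadov–Steger's Theorem 5 (containers for `F`-free
graphs) in the formalisation of the Rödl–Ruciński 1-statement
(`Literature.Probability.RandomGraphs.RodlRucinski1995_oneStatement`):

* `iterated_containers` — the standard iteration (Balogh–Morris–Samotij, ICM survey §3: "recursively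
  applying the lemma to subhypergraphs of `H` induced by all the containers `C` for which
  `e(H[C]) ≥ ε e(H)` eventually produces … containers … such that `e(H[C]) < ε e(H)`"): under
  `IterHyp` (each qualifying `C` is large and carries a bounded, large subfamily `H' ⊆ H[C]` to
  which BDTT's theorem applies — independent sets of `H` are independent in `H'`), after `R`
  rounds with `(1 - θ/2)^R < γ` every independent set has an `R × (k-1)` array of fingerprints
  and a container with fewer than `ε|H|` edges. The number of rounds is constant because each
  round shrinks the ground set by the factor `1 - θ/2`, `θ = η^{3^{k-1}}`.
* `exists_subfamily_hdeg_lt` — first-moment sparsification by double counting over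
  `H.powersetCard m`: if `∑_i C(deg_H(U_i), t_i) (m/|H|)^{t_i} < 1` then some `m`-subfamily `H'`
  has `deg_{H'}(U_i) < t_i` for all test sets `U_i`; with the term bound
  `choose_mul_pow_le_quarter_pow` (`12 d q ≤ t ⟹ C(d,t) q^t ≤ 4^{-t}`). This manufactures the
  homogeneous subfamilies BDTT's theorem needs when `H` itself is not homogeneous (e.g. the copy
  hypergraph of a graph that is not 2-balanced).

Everything is a theorem; no named facts.

## References

* J. Balogh, R. Morris, W. Samotij, *The method of hypergraph containers*, Proc. ICM 2018, §3.
  arXiv:1801.04584 (held). [BaloghMorrisSamotij2019]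
* A. Bernshteyn, M. Delcourt, H. Towsner, A. Tserunyan, Proc. AMS 147 (2019), Theorem 8.
  [BernshteynEtAl2019]
-/

namespace Literature.Combinatorics.Hypergraph

open Finset

variable {α : Type*} [DecidableEq α]

/-! ## Iterating the container theorem: containers with few edges

BMS survey §3 (after the lemma): "recursively applying the lemma to subhypergraphs of `H` induced
by all the containers `C` for which `e(H[C]) ≥ ε e(H)` eventually produces a collection of
containers indexed by sets of size `O(b)` such that `e(H[C]) < ε e(H)`". Since BDTT's theorem needs
a homogeneous hypergraph, each round is applied to a bounded, large subfamily `H' ⊆ H[C]` supplied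
by a hypothesis (`IterHyp.sparse`; for the copy hypergraph of a graph it comes from a random
subfamily); independent sets of `H` are independent in `H'`. -/

section Iterate

open scoped Classical

/-- The sub-family of `H` induced on a vertex set `C`: `H[C] = {e ∈ H : e ⊆ C}`. [folklore] -/
def induce (H : Finset (Finset α)) (C : Finset α) : Finset (Finset α) := H.filter fun e => e ⊆ C

/-- Membership in `H[C]`. [folklore] -/
theorem mem_induce {H : Finset (Finset α)} {C e : Finset α} : e ∈ induce H C ↔ e ∈ H ∧ e ⊆ C := by
  simp only [induce, mem_filter]

/-- `H[C] ⊆ H`. [folklore] -/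
theorem induce_subset (H : Finset (Finset α)) (C : Finset α) : induce H C ⊆ H := filter_subset _ _

/-- `H[C]` is monotone in `C`. [folklore] -/
theorem induce_mono (H : Finset (Finset α)) {C₁ C₂ : Finset α} (h : C₁ ⊆ C₂) :
    induce H C₁ ⊆ induce H C₂ := fun e he => by
  rw [mem_induce] at he ⊢
  exact ⟨he.1, he.2.trans h⟩

/-- `H[C]` is a family of `k`-subsets of `C`. [folklore] -/
theorem induce_subset_powersetCard {X : Finset α} {H : Finset (Finset α)} {k : ℕ}
    (hH : H ⊆ X.powersetCard k) (C : Finset α) : induce H C ⊆ C.powersetCard k := by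
  intro e he
  rw [mem_induce] at he
  rw [mem_powersetCard]
  exact ⟨he.2, (mem_powersetCard.1 (hH he.1)).2⟩

/-- The hypotheses of the iteration: a `k`-uniform family `H` on `X`, the BDTT parameters `D, η`,
an edge fraction `ε`, a size fraction `γ` such that every vertex set `C` carrying an
`ε`-fraction of the edges has `|C| ≥ γ|X|` and carries a `(k, D)`-bounded subfamily of size
`≥ η |C| D^{k-1}` (homogeneous sparsification), and the largeness conditions making one BDTT
round shrink `C` by the factor `1 - θ/2`, `θ = η^{3^{k-1}}`.
[cite: BaloghMorrisSamotij2019, §3 (iterating the container lemma)] -/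
structure IterHyp (X : Finset α) (H : Finset (Finset α)) (k : ℕ) (D η ε γ : ℝ) : Prop where
  hk : 1 ≤ k
  hH : H ⊆ X.powersetCard k
  hD : 0 < D
  hη : 0 < η
  hη2 : η ≤ 2⁻¹ ^ (2 * k)
  hγ : 0 < γ
  hDX : 2 ^ (k - 1) * D ≤ γ * #X
  hshrink : (k - 1 : ℝ) * (#X / D) ≤ η ^ (3 ^ (k - 1)) / 2 * (γ * #X)
  large : ∀ C ⊆ X, ε * #H ≤ #(induce H C) → γ * #X ≤ #C
  sparse : ∀ C ⊆ X, ε * #H ≤ #(induce H C) →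
    ∃ H' ⊆ induce H C, IsBounded H' k D ∧ η * #C * D ^ (k - 1) ≤ #H'

variable {X : Finset α} {H : Finset (Finset α)} {k : ℕ} {D η ε γ : ℝ}

/-- The chosen homogeneous subfamily of `H[C]` (junk `∅` when `C` does not qualify). [folklore] -/
noncomputable def hsel (S : IterHyp X H k D η ε γ) (C : Finset α) : Finset (Finset α) :=
  if h : C ⊆ X ∧ ε * #H ≤ #(induce H C) then Classical.choose (S.sparse C h.1 h.2) else ∅

/-- The defining property of `hsel`. [folklore] -/
theorem hsel_spec (S : IterHyp X H k D η ε γ) {C : Finset α} (h : C ⊆ X ∧ ε * #H ≤ #(induce H C)) :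
    hsel S C ⊆ induce H C ∧ IsBounded (hsel S C) k D ∧ η * #C * D ^ (k - 1) ≤ #(hsel S C) := by
  unfold hsel
  rw [dif_pos h]
  exact Classical.choose_spec (S.sparse C h.1 h.2)

/-- BDTT applies to `hsel S C` on the ground set `C`. [folklore] -/
theorem exists_pair_hsel (S : IterHyp X H k D η ε γ) {C : Finset α}
    (h : C ⊆ X ∧ ε * #H ≤ #(induce H C)) :
    ∃ (print : Finset α → (Fin (k - 1) → Finset α)) (cont : (Fin (k - 1) → Finset α) → Finset α),
      IsContainerPair C (hsel S C) (k - 1) (#C / D) (η ^ (3 ^ (k - 1)) * #C) print cont := by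
  obtain ⟨hsub, hbdd, hcard⟩ := hsel_spec S h
  have hC : γ * #X ≤ #C := S.large C h.1 h.2
  exact container_theorem C k S.hk (hsel S C) D η
    (hsub.trans (induce_subset_powersetCard S.hH C)) S.hD S.hη S.hη2 (S.hDX.trans hC) hbdd hcard

/-- One BDTT round on the ground set `C` (junk when `C` does not qualify). [folklore] -/
noncomputable def oneRound (S : IterHyp X H k D η ε γ) (C : Finset α) :
    (Finset α → (Fin (k - 1) → Finset α)) × ((Fin (k - 1) → Finset α) → Finset α) :=
  if h : C ⊆ X ∧ ε * #H ≤ #(induce H C) then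
    ⟨Classical.choose (exists_pair_hsel S h),
      Classical.choose (Classical.choose_spec (exists_pair_hsel S h))⟩
  else ⟨fun _ _ => ∅, fun _ => ∅⟩

/-- The defining property of `oneRound`. [folklore] -/
theorem oneRound_spec (S : IterHyp X H k D η ε γ) {C : Finset α}
    (h : C ⊆ X ∧ ε * #H ≤ #(induce H C)) :
    IsContainerPair C (hsel S C) (k - 1) (#C / D) (η ^ (3 ^ (k - 1)) * #C)
      (oneRound S C).1 (oneRound S C).2 := by
  unfold oneRound
  rw [dif_pos h]
  exact Classical.choose_spec (Classical.choose_spec (exists_pair_hsel S h))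

/-- The next ground set after one round with print `P`: `(C' ∪ ⋃ P) ∩ C`. [folklore] -/
noncomputable def nextGround (S : IterHyp X H k D η ε γ) (C : Finset α)
    (P : Fin (k - 1) → Finset α) : Finset α :=
  ((oneRound S C).2 P ∪ Finset.univ.biUnion P) ∩ C

/-- `nextGround ⊆ C`. [folklore] -/
theorem nextGround_subset (S : IterHyp X H k D η ε γ) (C : Finset α) (P : Fin (k - 1) → Finset α) :
    nextGround S C P ⊆ C := inter_subset_right

/-- `r` rounds of the iteration started at the ground set `C`: the print map (an `r`-tuple of BDTT
prints) and the container map. [cite: BaloghMorrisSamotij2019, §3 (iterating the container lemma)] -/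
noncomputable def rounds (S : IterHyp X H k D η ε γ) : (r : ℕ) → Finset α →
    (Finset α → (Fin r → Fin (k - 1) → Finset α)) × ((Fin r → Fin (k - 1) → Finset α) → Finset α)
  | 0, C => ⟨fun _ i => i.elim0, fun _ => C⟩
  | r + 1, C =>
    if (#(induce H C) : ℝ) < ε * #H then ⟨fun _ _ _ => ∅, fun _ => C⟩
    else ⟨fun I => Fin.cons ((oneRound S C).1 I) ((rounds S r (nextGround S C ((oneRound S C).1 I))).1 I),
      fun P => (rounds S r (nextGround S C (P 0))).2 (Fin.tail P)⟩

/-- **The invariant of the iteration.** After `r` rounds from `C ⊆ X`, every `H`-independent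
`I ⊆ C` has fingerprints inside `I` of size `≤ |X|/D`, is contained in its container, the
container lies in `C`, and either the container carries fewer than `ε|H|` edges or it has size
`≤ (1 - θ/2)^r |C|`. [cite: BaloghMorrisSamotij2019, §3 (iterating the container lemma)] -/
theorem rounds_spec (S : IterHyp X H k D η ε γ) (r : ℕ) :
    ∀ C ⊆ X, ∀ I ⊆ C, IsIndep H I →
      (∀ ρ i, (rounds S r C).1 I ρ i ⊆ I ∧ (#((rounds S r C).1 I ρ i) : ℝ) ≤ #X / D) ∧
      (rounds S r C).2 ((rounds S r C).1 I) ⊆ C ∧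
      I ⊆ (rounds S r C).2 ((rounds S r C).1 I) ∧
      ((#(induce H ((rounds S r C).2 ((rounds S r C).1 I))) : ℝ) < ε * #H ∨
        (#((rounds S r C).2 ((rounds S r C).1 I)) : ℝ) ≤ (1 - η ^ (3 ^ (k - 1)) / 2) ^ r * #C) := by
  induction r with
  | zero =>
    intro C hC I hI hind
    refine ⟨fun ρ => ρ.elim0, ?_, ?_, Or.inr ?_⟩
    · simp [rounds]
    · simpa [rounds] using hI
    · simp [rounds]
  | succ r ih =>
    intro C hC I hI hind
    by_cases hlt : (#(induce H C) : ℝ) < ε * #H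
    · simp only [rounds, if_pos hlt]
      refine ⟨fun ρ i => ⟨empty_subset _, ?_⟩, Subset.rfl, hI, Or.inl hlt⟩
      simp only [card_empty, Nat.cast_zero]
      exact div_nonneg (Nat.cast_nonneg _) S.hD.le
    · have hq : C ⊆ X ∧ ε * #H ≤ #(induce H C) := ⟨hC, le_of_not_gt hlt⟩
      have hpair := oneRound_spec S hq
      set P₁ := (oneRound S C).1 I with hP₁
      have hind' : IsIndep (hsel S C) I := hind.anti ((hsel_spec S hq).1.trans (induce_subset H C))
      have hP₁I : ∀ i, P₁ i ⊆ I := hpair.print_subset I hI hind'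
      have hIC₁ : I ⊆ nextGround S C P₁ := by
        intro x hx
        unfold nextGround
        rw [mem_inter]
        refine ⟨?_, hI hx⟩
        have := hpair.subset_cont I hI hind' hx
        rw [mem_union] at this ⊢
        exact this.symm
      have hC₁C : nextGround S C P₁ ⊆ C := nextGround_subset S C P₁
      obtain ⟨hpr, hco, hIco, halt⟩ := ih (nextGround S C P₁) (hC₁C.trans hC) I hIC₁ hind
      simp only [rounds, if_neg hlt]
      refine ⟨?_, ?_, ?_, ?_⟩
      · intro ρ
        refine Fin.cases ?_ (fun ρ => ?_) ρ
        · intro i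
          rw [Fin.cons_zero]
          refine ⟨hP₁I i, (hpair.card_print_le I hI hind' i).trans ?_⟩
          exact div_le_div_of_nonneg_right (by exact_mod_cast card_le_card hC) S.hD.le
        · intro i
          rw [Fin.cons_succ]
          exact hpr ρ i
      · rw [Fin.cons_zero, Fin.tail_cons]
        exact hco.trans hC₁C
      · rw [Fin.cons_zero, Fin.tail_cons]
        exact hIco
      · rw [Fin.cons_zero, Fin.tail_cons]
        rcases halt with hlt' | hsize
        · exact Or.inl hlt'
        · right
          refine hsize.trans ?_
          -- `|C₁| ≤ (1 - θ/2) |C|`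
          have hθ : 0 ≤ η ^ (3 ^ (k - 1)) := pow_nonneg S.hη.le _
          have hθ1 : η ^ (3 ^ (k - 1)) ≤ 1 := by
            apply pow_le_one₀ S.hη.le
            exact S.hη2.trans (pow_le_one₀ (by norm_num) (by norm_num))
          have hγC : γ * #X ≤ #C := S.large C hq.1 hq.2
          have hcont : (#((oneRound S C).2 P₁) : ℝ) ≤ #C - η ^ (3 ^ (k - 1)) * #C := by
            have h1 := hpair.le_card_sdiff I hI hind'
            have h2 : (#(C \ (oneRound S C).2 P₁) : ℝ) = #C - #((oneRound S C).2 P₁) := by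
              rw [card_sdiff_of_subset (hpair.cont_subset P₁)]
              push_cast [Nat.cast_sub (card_le_card (hpair.cont_subset P₁))]
              ring
            linarith
          have hprints : (#(Finset.univ.biUnion P₁) : ℝ) ≤ (k - 1 : ℝ) * (#X / D) := by
            calc (#(Finset.univ.biUnion P₁) : ℝ) ≤ ∑ i : Fin (k - 1), (#(P₁ i) : ℝ) := by
                  exact_mod_cast card_biUnion_le
              _ ≤ ∑ _i : Fin (k - 1), #X / D := sum_le_sum fun i _ =>
                  (hpair.card_print_le I hI hind' i).trans
                    (div_le_div_of_nonneg_right (by exact_mod_cast card_le_card hC) S.hD.le)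
              _ = (k - 1 : ℝ) * (#X / D) := by
                  rw [sum_const, card_univ, Fintype.card_fin, nsmul_eq_mul]
                  rw [Nat.cast_sub S.hk, Nat.cast_one]
          have hC₁ : (#(nextGround S C P₁) : ℝ) ≤ (1 - η ^ (3 ^ (k - 1)) / 2) * #C := by
            calc (#(nextGround S C P₁) : ℝ)
                ≤ #((oneRound S C).2 P₁ ∪ Finset.univ.biUnion P₁) := by
                  exact_mod_cast card_le_card inter_subset_left
              _ ≤ #((oneRound S C).2 P₁) + #(Finset.univ.biUnion P₁) := by
                  exact_mod_cast card_union_le _ _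
              _ ≤ (#C - η ^ (3 ^ (k - 1)) * #C) + η ^ (3 ^ (k - 1)) / 2 * (γ * #X) :=
                  add_le_add hcont (hprints.trans S.hshrink)
              _ ≤ (#C - η ^ (3 ^ (k - 1)) * #C) + η ^ (3 ^ (k - 1)) / 2 * #C := by
                  have := mul_le_mul_of_nonneg_left hγC (by positivity : 0 ≤ η ^ (3 ^ (k - 1)) / 2)
                  linarith
              _ = (1 - η ^ (3 ^ (k - 1)) / 2) * #C := by ring
          calc (1 - η ^ (3 ^ (k - 1)) / 2) ^ r * (#(nextGround S C P₁) : ℝ)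
              ≤ (1 - η ^ (3 ^ (k - 1)) / 2) ^ r * ((1 - η ^ (3 ^ (k - 1)) / 2) * #C) := by
                apply mul_le_mul_of_nonneg_left hC₁
                apply pow_nonneg
                linarith
            _ = (1 - η ^ (3 ^ (k - 1)) / 2) ^ (r + 1) * #C := by ring

/-- **Iterated containers with few edges (Balogh–Morris–Samotij, survey §3; Nenadov–Steger Thm. 5
in abstract form).** Under `IterHyp`, after `R` rounds with `(1 - θ/2)^R < γ` every
`H`-independent set `I ⊆ X` has an `R × (k-1)` array of fingerprints `⊆ I`, each of size
`≤ |X|/D`, whose container (a function of the fingerprints alone) contains `I`, lies in `X`, and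
carries fewer than `ε |H|` edges of `H`. [cite: BaloghMorrisSamotij2019, §3 (iterating the container lemma)] -/
theorem iterated_containers (S : IterHyp X H k D η ε γ) (R : ℕ)
    (hR : (1 - η ^ (3 ^ (k - 1)) / 2) ^ R < γ) :
    ∃ (Print : Finset α → (Fin R → Fin (k - 1) → Finset α))
      (Cont : (Fin R → Fin (k - 1) → Finset α) → Finset α),
      ∀ I ⊆ X, IsIndep H I →
        (∀ ρ i, Print I ρ i ⊆ I ∧ (#(Print I ρ i) : ℝ) ≤ #X / D) ∧
        Cont (Print I) ⊆ X ∧ I ⊆ Cont (Print I) ∧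
        (#(induce H (Cont (Print I))) : ℝ) < ε * #H := by
  refine ⟨(rounds S R X).1, (rounds S R X).2, fun I hI hind => ?_⟩
  obtain ⟨hpr, hco, hIco, halt⟩ := rounds_spec S R X Subset.rfl I hI hind
  refine ⟨hpr, hco, hIco, ?_⟩
  rcases halt with h | hsize
  · exact h
  · by_contra hge
    push Not at hge
    have hγC := S.large _ hco hge
    have hX : (0 : ℝ) < #X := by
      have h1 : (0 : ℝ) < 2 ^ (k - 1) * D := by have := S.hD; positivity
      have h3 : 0 < γ * (#X : ℝ) := h1.trans_le S.hDX
      by_contra h0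
      push Not at h0
      have : (#X : ℝ) = 0 := le_antisymm h0 (Nat.cast_nonneg _)
      rw [this, mul_zero] at h3
      exact lt_irrefl _ h3
    have : γ * (#X : ℝ) ≤ (1 - η ^ (3 ^ (k - 1)) / 2) ^ R * #X := hγC.trans hsize
    have := lt_of_le_of_lt this (mul_lt_mul_of_pos_right hR hX)
    exact lt_irrefl _ this

end Iterate


/-! ## Sparsification: a subfamily of prescribed size with small co-degrees (first-moment counting)

A uniformly random `m`-subfamily `H'` of `H` has `deg_{H'}(u) ≥ t` with probability at most
`C(deg_H(u), t) · C(|H|-t, m-t)/C(|H|, m) ≤ C(deg_H(u), t) (m/|H|)^t`; a union bound over a family of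
test sets gives a subfamily beating all thresholds. Phrased and proved by double counting over
`H.powersetCard m` (no probability). This supplies the homogeneous subfamilies BDTT's theorem needs
(`IterHyp.sparse`) for inhomogeneous hypergraphs such as the copy hypergraph of a non-balanced graph.
-/

section Sparsify

variable {β : Type*} [DecidableEq β]

/-- Supersets of a fixed `T ⊆ H` among the `m`-subfamilies of `H` inject into the
`(m - |T|)`-subfamilies of `H ∖ T`: there are at most `C(|H| - |T|, m - |T|)` of them. [folklore] -/
theorem card_filter_powersetCard_superset_le (H T : Finset β) (hT : T ⊆ H) (m : ℕ) :
    #((H.powersetCard m).filter fun S => T ⊆ S) ≤ (#H - #T).choose (m - #T) := by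
  classical
  rw [← card_sdiff_of_subset hT, ← card_powersetCard]
  refine card_le_card_of_injOn (fun S => S \ T) (fun S hS => ?_) (fun S₁ hS₁ S₂ hS₂ h => ?_)
  · simp only [coe_filter, Set.mem_setOf_eq, mem_powersetCard] at hS
    rw [mem_coe, mem_powersetCard]
    exact ⟨sdiff_subset_sdiff hS.1.1 Subset.rfl, by rw [card_sdiff_of_subset hS.2, hS.1.2]⟩
  · simp only [coe_filter, Set.mem_setOf_eq, mem_powersetCard] at hS₁ hS₂
    have := congrArg (fun S => S ∪ T) h
    simp only [sdiff_union_of_subset hS₁.2, sdiff_union_of_subset hS₂.2] at this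
    exact this

/-- `C(m, t) · E^t ≤ C(E, t) · m^t` for `m ≤ E`, via descending factorials:
`∏_{i<t} (m - i) E ≤ ∏_{i<t} (E - i) m`. [folklore] -/
theorem descFactorial_mul_pow_le {m E : ℕ} (hmE : m ≤ E) (t : ℕ) :
    m.descFactorial t * E ^ t ≤ E.descFactorial t * m ^ t := by
  induction t with
  | zero => simp
  | succ t ih =>
    rw [Nat.descFactorial_succ, Nat.descFactorial_succ, pow_succ, pow_succ]
    have hstep : (m - t) * E ≤ (E - t) * m := by
      rcases le_or_gt t m with htm | htm
      · have h1 : (m - t) * E + t * E = m * E := by rw [← Nat.add_mul, Nat.sub_add_cancel htm]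
        have h2 : (E - t) * m + t * m = E * m := by rw [← Nat.add_mul, Nat.sub_add_cancel (htm.trans hmE)]
        nlinarith [Nat.mul_le_mul_left t hmE]
      · rw [Nat.sub_eq_zero_of_le htm.le, zero_mul]; exact Nat.zero_le _
    calc (m - t) * m.descFactorial t * (E ^ t * E)
        = (m.descFactorial t * E ^ t) * ((m - t) * E) := by ring
      _ ≤ (E.descFactorial t * m ^ t) * ((E - t) * m) := Nat.mul_le_mul ih hstep
      _ = (E - t) * E.descFactorial t * (m ^ t * m) := by ring

/-- The hypergeometric tail factor: `C(E - t, m - t) ≤ C(E, m) · (m/E)^t` for `t ≤ m ≤ E`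
(`= Pr[a fixed t-set ⊆ a uniform m-subset of an E-set] · C(E, m)`). [folklore] -/
theorem choose_sub_le_choose_mul_pow {E m t : ℕ} (htm : t ≤ m) (hmE : m ≤ E) :
    ((E - t).choose (m - t) : ℝ) ≤ (E.choose m : ℝ) * ((m : ℝ) / E) ^ t := by
  rcases Nat.eq_zero_or_pos E with hE | hE
  · subst hE
    have hm : m = 0 := by omega
    have ht : t = 0 := by omega
    subst hm; subst ht; simp
  have hEt : 0 < E.choose t := Nat.choose_pos (htm.trans hmE)
  -- `C(E, m) C(m, t) = C(E, t) C(E - t, m - t)`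
  have hid := Nat.choose_mul (n := E) (k := m) (s := t) htm
  have hidR : (E.choose m : ℝ) * (m.choose t) = (E.choose t) * ((E - t).choose (m - t)) := by
    exact_mod_cast hid
  -- `C(m, t) E^t ≤ C(E, t) m^t`
  have hdf := descFactorial_mul_pow_le hmE t
  have hch : (m.choose t : ℝ) * (E : ℝ) ^ t ≤ (E.choose t : ℝ) * (m : ℝ) ^ t := by
    have h1 : (m.choose t : ℝ) * (t.factorial : ℝ) = m.descFactorial t := by
      rw [Nat.descFactorial_eq_factorial_mul_choose]; push_cast; ring
    have h2 : (E.choose t : ℝ) * (t.factorial : ℝ) = E.descFactorial t := by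
      rw [Nat.descFactorial_eq_factorial_mul_choose]; push_cast; ring
    have hf : (0 : ℝ) < t.factorial := by exact_mod_cast Nat.factorial_pos t
    have hdfR : (m.descFactorial t : ℝ) * (E : ℝ) ^ t ≤ (E.descFactorial t : ℝ) * (m : ℝ) ^ t := by
      exact_mod_cast hdf
    rw [← h1, ← h2] at hdfR
    nlinarith
  have hEpos : (0 : ℝ) < (E : ℝ) ^ t := by positivity
  rw [div_pow, mul_div_assoc', le_div_iff₀ hEpos]
  have hEtR : (0 : ℝ) < E.choose t := by exact_mod_cast hEt
  nlinarith [hidR, hch, hEtR]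

/-- **First-moment sparsification.** Let `H` be a finite family, `m ≤ |H|`, and let
`(U_i, t_i)_{i ∈ B}` be test sets with thresholds. If
`∑_i C(deg_H(U_i), t_i) (m/|H|)^{t_i} < 1` then some `m`-subfamily `H' ⊆ H` has
`deg_{H'}(U_i) < t_i` for all `i` (the expected number of pairs `(i, T)`, `T` a `t_i`-set of
edges of `H'` through `U_i`, is `< 1`). [folklore] -/
theorem exists_subfamily_hdeg_lt {ι : Type*} (H : Finset (Finset β)) {m : ℕ} (hm : m ≤ #H)
    (B : Finset ι) (U : ι → Finset β) (t : ι → ℕ)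
    (h : ∑ i ∈ B, ((hdeg H (U i)).choose (t i) : ℝ) * ((m : ℝ) / #H) ^ (t i) < 1) :
    ∃ H' ⊆ H, #H' = m ∧ ∀ i ∈ B, hdeg H' (U i) < t i := by
  classical
  -- only thresholds `t_i ≤ m` can be violated
  set B' := B.filter fun i => t i ≤ m with hB'
  by_contra hno
  push Not at hno
  have hcover : H.powersetCard m ⊆ B'.biUnion fun i =>
      ((H.filter fun e => U i ⊆ e).powersetCard (t i)).biUnion fun T =>
        (H.powersetCard m).filter fun S => T ⊆ S := by
    intro S hS
    have hS' := mem_powersetCard.1 hS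
    obtain ⟨i, hiB, hi⟩ := hno S hS'.1 hS'.2
    rw [mem_biUnion]
    have htim : t i ≤ m := by
      refine hi.trans ?_
      rw [← hS'.2]
      exact card_le_card (filter_subset _ _)
    refine ⟨i, mem_filter.2 ⟨hiB, htim⟩, ?_⟩
    rw [mem_biUnion]
    obtain ⟨T, hTsub, hTcard⟩ := exists_subset_card_eq hi
    refine ⟨T, ?_, ?_⟩
    · rw [mem_powersetCard]
      refine ⟨hTsub.trans ?_, hTcard⟩
      exact filter_subset_filter _ hS'.1
    · rw [mem_filter]
      exact ⟨hS, hTsub.trans (filter_subset _ _)⟩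
  have hcard := card_le_card hcover
  rw [card_powersetCard] at hcard
  -- count the cover
  have hcount : (#(B'.biUnion fun i =>
      ((H.filter fun e => U i ⊆ e).powersetCard (t i)).biUnion fun T =>
        (H.powersetCard m).filter fun S => T ⊆ S) : ℝ) ≤
      ∑ i ∈ B', ((hdeg H (U i)).choose (t i) : ℝ) * ((#H - t i).choose (m - t i) : ℝ) := by
    calc (#(B'.biUnion fun i => ((H.filter fun e => U i ⊆ e).powersetCard (t i)).biUnion fun T =>
            (H.powersetCard m).filter fun S => T ⊆ S) : ℝ)
        ≤ ∑ i ∈ B', (#(((H.filter fun e => U i ⊆ e).powersetCard (t i)).biUnion fun T =>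
            (H.powersetCard m).filter fun S => T ⊆ S) : ℝ) := by
          exact_mod_cast card_biUnion_le
      _ ≤ ∑ i ∈ B', ∑ T ∈ (H.filter fun e => U i ⊆ e).powersetCard (t i),
            (#((H.powersetCard m).filter fun S => T ⊆ S) : ℝ) := by
          refine sum_le_sum fun i _ => ?_
          exact_mod_cast card_biUnion_le
      _ ≤ ∑ i ∈ B', ∑ _T ∈ (H.filter fun e => U i ⊆ e).powersetCard (t i),
            ((#H - t i).choose (m - t i) : ℝ) := by
          refine sum_le_sum fun i _ => sum_le_sum fun T hT => ?_
          have hT' := mem_powersetCard.1 hT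
          have := card_filter_powersetCard_superset_le H T (hT'.1.trans (filter_subset _ _)) m
          rw [hT'.2] at this
          exact_mod_cast this
      _ = ∑ i ∈ B', ((hdeg H (U i)).choose (t i) : ℝ) * ((#H - t i).choose (m - t i) : ℝ) := by
          refine sum_congr rfl fun i _ => ?_
          rw [sum_const, card_powersetCard, nsmul_eq_mul]
          rfl
  -- compare with `C(|H|, m)` using the hypergeometric factor
  have hterms : ∑ i ∈ B', ((hdeg H (U i)).choose (t i) : ℝ) * ((#H - t i).choose (m - t i) : ℝ) ≤
      ((#H).choose m : ℝ) * ∑ i ∈ B', ((hdeg H (U i)).choose (t i) : ℝ) * ((m : ℝ) / #H) ^ (t i) := by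
    rw [mul_sum]
    refine sum_le_sum fun i hi => ?_
    have htim : t i ≤ m := (mem_filter.1 hi).2
    have := choose_sub_le_choose_mul_pow htim hm
    calc ((hdeg H (U i)).choose (t i) : ℝ) * ((#H - t i).choose (m - t i) : ℝ)
        ≤ ((hdeg H (U i)).choose (t i) : ℝ) * (((#H).choose m : ℝ) * ((m : ℝ) / #H) ^ (t i)) :=
          mul_le_mul_of_nonneg_left this (by positivity)
      _ = _ := by ring
  have hsum' : ∑ i ∈ B', ((hdeg H (U i)).choose (t i) : ℝ) * ((m : ℝ) / #H) ^ (t i) < 1 := by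
    refine lt_of_le_of_lt ?_ h
    exact sum_le_sum_of_subset_of_nonneg (filter_subset _ _) fun _ _ _ => by positivity
  have hpos : (0 : ℝ) < (#H).choose m := by exact_mod_cast Nat.choose_pos hm
  have hlt : ∑ i ∈ B', ((hdeg H (U i)).choose (t i) : ℝ) * ((#H - t i).choose (m - t i) : ℝ) <
      (#H).choose m := by
    calc _ ≤ ((#H).choose m : ℝ) * ∑ i ∈ B', ((hdeg H (U i)).choose (t i) : ℝ) *
          ((m : ℝ) / #H) ^ (t i) := hterms
      _ < ((#H).choose m : ℝ) * 1 := mul_lt_mul_of_pos_left hsum' hpos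
      _ = _ := mul_one _
  have hcardR : ((#H).choose m : ℝ) ≤ #(B'.biUnion fun i =>
      ((H.filter fun e => U i ⊆ e).powersetCard (t i)).biUnion fun T =>
        (H.powersetCard m).filter fun S => T ⊆ S) := by exact_mod_cast hcard
  linarith

/-- The term bound used with the sparsification lemma: if `12 · d · q ≤ t` then
`C(d, t) q^t ≤ 4^{-t}` (`C(d,t) ≤ d^t/t!`, `t^t/t! ≤ e^t`, `e/12 < 1/4`). [folklore] -/
theorem choose_mul_pow_le_quarter_pow {d t : ℕ} {q : ℝ} (hq : 0 ≤ q) (h : 12 * (d : ℝ) * q ≤ t) :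
    (d.choose t : ℝ) * q ^ t ≤ 4⁻¹ ^ t := by
  have hfac : (0 : ℝ) < t.factorial := by exact_mod_cast Nat.factorial_pos t
  have h1 : (d.choose t : ℝ) ≤ (d : ℝ) ^ t / t.factorial := Nat.choose_le_pow_div t d
  have h2 : (d.choose t : ℝ) * q ^ t ≤ ((d : ℝ) * q) ^ t / t.factorial := by
    rw [mul_pow, mul_div_right_comm]
    exact mul_le_mul_of_nonneg_right h1 (by positivity)
  have h3 : ((d : ℝ) * q) ^ t ≤ ((t : ℝ) / 12) ^ t := by
    apply pow_le_pow_left₀ (by positivity)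
    linarith
  have h5 : (t : ℝ) ^ t / t.factorial ≤ Real.exp t :=
    Real.pow_div_factorial_le_exp (t : ℝ) (Nat.cast_nonneg t) t
  have h6 : Real.exp t ≤ 3 ^ t := by
    rw [show (t : ℝ) = t * 1 by ring, Real.exp_nat_mul]
    exact pow_le_pow_left₀ (Real.exp_pos 1).le Real.exp_one_lt_three.le t
  calc (d.choose t : ℝ) * q ^ t ≤ ((d : ℝ) * q) ^ t / t.factorial := h2
    _ ≤ ((t : ℝ) / 12) ^ t / t.factorial := div_le_div_of_nonneg_right h3 hfac.le
    _ = ((t : ℝ) ^ t / t.factorial) * 12⁻¹ ^ t := by rw [div_pow, inv_pow]; ring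
    _ ≤ 3 ^ t * 12⁻¹ ^ t := mul_le_mul_of_nonneg_right (h5.trans h6) (by positivity)
    _ = 4⁻¹ ^ t := by rw [← mul_pow]; norm_num

end Sparsify

end Literature.Combinatorics.Hypergraph
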